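import Summits.QuantumFields.BalabanUV.T4Continuum.Support.BlockAverageGaugeExtract
import Summits.QuantumFields.BalabanUV.T4Continuum.Support.UnitaryRootInterpolation
import Literature.MathematicalPhysics.QuantumFieldTheory.Balaban1983to89.B7BlockAvgLog

/-!
# T⁴ programme, node NE3, row S6-Y7 (P3 leaf L7 «SLOP», k-level input (K4)) — GAUGE EXTRACTION, CONFIGURATION-LEVEL
# PACKAGING: `W·e^{gaugeDir W Λ + R} = (W·e^{R′})^{e^{Λ}}` AS CONFIGURATIONS, periodicity and skewness of `R′`, the
# interaction bound in configuration dress, exactness at uncharged bonds (`BlockAverageGaugeExtractCfg`)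

Cell `pub-balaban`, NE3 (node U1b) formalisation swarm `b2b-balaban-t4-ne3-formalise-*`, unit
`b2b-balaban-t4-ne3-formalise-leaf-02` (LEAF PROVER 02, gen 3); sub-row **S6-Y7-K4-cfg** of `t4/formal/NE3/LEAVES.md` (typer
RULING ρ78: the bond-level (K4) — `gaugeExtract`, `exp_gaugeExtract`, `val_mul_exp_gaugeDir_add`, `norm_gaugeExtract_sub_le` —
is leaf-10 g2's `BlockAverageGaugeExtract` (p216501) over `BlockAverageLogInteraction` (p216364); THIS file is the
configuration-level packaging asked of this seat).  SHAPE: leaf-10 g2's `Statements/S6-Y7-SHAPE-v1.md` §2′ (K4).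

CONTENT (0 def, 0 sorry; everything BY NAME over p216501):
* §1 `isPeriodicDir_gaugeExtract` — periodic data give a periodic extracted field; `norm_gaugeTwist_sub_one_le` — at charges and
  remainder below `1∕64` the bond twist `e^{−Ad_{W(b)⁻¹}Λ(x)}·e^{gaugeDir W Λ (b) + R(b)}·e^{Λ(x+e_μ)}` is within `1∕4` of `1`;
  **`isSkewDir_gaugeExtract`** — for `U(N)` data, skew charges and a skew remainder the extracted field is skew (the twist is a
  product of three unitaries; (22)–(23) `smul_mlog_mem_skewAdjoint`);
* §2 **`vary_gaugeDir_add_eq_gaugeAct`** — THE CONFIGURATION IDENTITY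
  `vary W (gaugeDir W Λ + R) 1 = gaugeAct (expGauge Λ 1) (vary W (gaugeExtract W Λ R) 1)`: moving `W` along a direction with
  gauge component `gaugeDir W Λ` IS the gauge transformation by `e^{Λ}` of `W` moved along the extracted non-gauge field
  (bondwise `val_mul_exp_gaugeDir_add`);
* §3 the interaction bound in configuration dress: pointwise `‖R′(b) − R(b)‖ ≤ 2048·(‖Λ(x)‖·‖Λ(x+e_μ)‖ + (‖Λ(x)‖ + ‖Λ(x+e_μ)‖)·‖R(b)‖)`
  (the product of the charges AT THE TWO ENDS of `b` kept visible — it vanishes for isolated charges), and the sup corollary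
  `≤ 2048·(ℓ² + 2ℓr)` for `‖Λ‖_∞ ≤ ℓ`, `‖R‖_∞ ≤ r`;
* §4 exactness: `gaugeExtract W 0 R = R` (no charges: `mlog_exp`), and `gaugeExtract W Λ 0 (b) = 0` whenever one end of `b`
  carries no charge (an isolated charge is extracted EXACTLY, the point of leaf-10's SHAPE v1.1 counterexample).

HONEST FRAMING (T4-DAG p. 1).  Bookkeeping over a landed one-bond lemma; kinematics of ONE configuration; nothing multiscale —
(K5) (the induction with the pair-interaction functional) and (K6) remain OPEN, and L7(a) at k levels stays road P3's typed binder
((R1)); nothing about Bałaban's minimisers; NE3 NOT proved; spine PROVED 0∕9; finite T⁴ rung (B)+1 — NOT infinite volume, NOT a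
mass gap, NOT `BetaPertH`, NOT the Clay problem.  ABSOLUTE RULE kept: no printed sentence is a hypothesis; no `def … : Prop` fact;
no `sorry`.  PLACEMENT: `Summits/QuantumFields/BalabanUV/`.  HONEST DEPENDENCY: continuum YM on T⁴ ⇐ BetaPertH ∧ nine spine
estimates (0/9 proved); BetaPertH ⇐ (D1) ∧ (D4) ∧ CAP+tail; G-an2-4 gates asym, D1 and NE2/3/4.
-/

set_option autoImplicit false

open scoped BigOperators Matrix.Norms.L2Operator Topology
open NormedSpace Finset

namespace Summit.QuantumFields.BalabanUV.T4Continuum.BlockAverageGaugeExtractCfg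

open Literature.MathematicalPhysics.QuantumFieldTheory.Balaban1983to89
open B7Prop1Explicit B7Prop2Explicit MatrixLog UnitaryModel
open T4AveragingDeficitWall hiding Site Plane Plaq Bond
open T4AveragingDeficitWallBoundary (IsPeriodicCfg)
open AveragingDeficitPeriodicCounting (IsPeriodicDir)
open BlockAveragePushDirGauge (gaugeDir expGauge)
open BlockAverageLogInteraction (norm_exp_sub_one_le_two_mul norm_mul3_sub_one_le)
open BlockAverageGaugeExtract (gaugeExtract exp_gaugeExtract val_mul_exp_gaugeDir_add norm_gaugeExtract_sub_le)

noncomputable section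

variable {d : ℕ} {n : Type*} [Fintype n] [DecidableEq n]

/-! ## §1 Periodicity, near-identity of the twist, skewness of the extracted field -/

section Bookkeeping

variable [Nonempty n]

omit [Nonempty n] in
/-- **PERIODIC DATA GIVE A PERIODIC EXTRACTED FIELD.** [folklore] -/
theorem isPeriodicDir_gaugeExtract {W : Site d → Fin d → (Matrix n n ℂ)ˣ} {Λ : Site d → Matrix n n ℂ}
    {R : Site d → Fin d → Matrix n n ℂ} {P : ℤ} (hW : IsPeriodicCfg W P)
    (hΛ : ∀ (x : Site d) (i : Fin d), Λ (x + P • e i) = Λ x) (hR : IsPeriodicDir R P) :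
    IsPeriodicDir (gaugeExtract W Λ R) P := by
  intro x i μ
  simp only [gaugeExtract, gaugeDir]
  rw [hW x i μ, hΛ x i, add_right_comm, hΛ (x + e μ) i, hR x i μ]

/-- **THE BOND TWIST IS WITHIN `1∕4` OF `1`** when the charges at both ends and the remainder are below `1∕64` (`U(N)` bond
variable): `‖e^{−Ad_{W(b)⁻¹}Λ(x)}·e^{gaugeDir W Λ (b) + R(b)}·e^{Λ(x+e_μ)} − 1‖ ≤ 1∕4`. [folklore] -/
theorem norm_gaugeTwist_sub_one_le {W : Site d → Fin d → (Matrix n n ℂ)ˣ} (hW : IsUnitaryCfg W)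
    (Λ : Site d → Matrix n n ℂ) (R : Site d → Fin d → Matrix n n ℂ) (x : Site d) (μ : Fin d)
    (hΛx : ‖Λ x‖ < 1 / 64) (hΛx' : ‖Λ (x + e μ)‖ < 1 / 64) (hR : ‖R x μ‖ < 1 / 64) :
    ‖exp (-(Ad (W x μ)⁻¹ (Λ x))) * exp (gaugeDir W Λ x μ + R x μ) * exp (Λ (x + e μ)) - 1‖ ≤ 1 / 4 := by
  have ha : ‖Ad (W x μ)⁻¹ (Λ x)‖ = ‖Λ x‖ :=
    AveragingDeficitTransport.norm_Ad_of_unitary ((unitaryUnits _).inv_mem (hW x μ)) _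
  have h1 : ‖-(Ad (W x μ)⁻¹ (Λ x))‖ ≤ 1 / 64 := by rw [norm_neg, ha]; exact hΛx.le
  have h2 : ‖gaugeDir W Λ x μ + R x μ‖ ≤ 3 / 64 := by
    simp only [gaugeDir]
    calc ‖Ad (W x μ)⁻¹ (Λ x) - Λ (x + e μ) + R x μ‖
        ≤ ‖Ad (W x μ)⁻¹ (Λ x) - Λ (x + e μ)‖ + ‖R x μ‖ := norm_add_le _ _
      _ ≤ (‖Ad (W x μ)⁻¹ (Λ x)‖ + ‖Λ (x + e μ)‖) + ‖R x μ‖ := add_le_add (norm_sub_le _ _) le_rfl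
      _ ≤ 3 / 64 := by rw [ha]; linarith
  have h3 : ‖Λ (x + e μ)‖ ≤ 1 / 64 := hΛx'.le
  obtain ⟨e1, -⟩ := norm_exp_sub_one_le_two_mul h1 (by norm_num)
  obtain ⟨e2, -⟩ := norm_exp_sub_one_le_two_mul h2 (by norm_num)
  obtain ⟨e3, -⟩ := norm_exp_sub_one_le_two_mul h3 (by norm_num)
  exact (norm_mul3_sub_one_le e1 e2 e3).trans (by norm_num)

/-- **THE EXTRACTED FIELD IS SKEW** for `U(N)` bond variables, skew-hermitian charges `Λ` and a skew remainder `R` (charges and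
remainder below `1∕64`): the twist is a product of three unitaries within `1∕4` of `1`, whose logarithm (21) is skew-hermitian
((22)–(23), tree `smul_mlog_mem_skewAdjoint`). [folklore] -/
theorem isSkewDir_gaugeExtract {W : Site d → Fin d → (Matrix n n ℂ)ˣ} (hW : IsUnitaryCfg W) {Λ : Site d → Matrix n n ℂ}
    (hΛ : ∀ x, Λ x ∈ skewAdjoint (Matrix n n ℂ)) {R : Site d → Fin d → Matrix n n ℂ} (hR : IsSkewDir R)
    (hΛs : ∀ x, ‖Λ x‖ < 1 / 64) (hRs : ∀ x μ, ‖R x μ‖ < 1 / 64) :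
    IsSkewDir (gaugeExtract W Λ R) := by
  letI : NormedAlgebra ℚ (Matrix n n ℂ) := NormedAlgebra.restrictScalars ℚ ℝ (Matrix n n ℂ)
  letI : CStarAlgebra (Matrix n n ℂ) := {}
  intro x μ
  have ha : Ad (W x μ)⁻¹ (Λ x) ∈ skewAdjoint (Matrix n n ℂ) :=
    AveragingDeficitTransport.Ad_mem_skewAdjoint ((unitaryUnits _).inv_mem (hW x μ)) (hΛ x)
  have hs1 : -(Ad (W x μ)⁻¹ (Λ x)) ∈ skewAdjoint (Matrix n n ℂ) := (skewAdjoint _).neg_mem ha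
  have hs2 : gaugeDir W Λ x μ + R x μ ∈ skewAdjoint (Matrix n n ℂ) := by
    simp only [gaugeDir]
    exact (skewAdjoint _).add_mem ((skewAdjoint _).sub_mem ha (hΛ _)) (hR x μ)
  have hu : exp (-(Ad (W x μ)⁻¹ (Λ x))) * exp (gaugeDir W Λ x μ + R x μ) * exp (Λ (x + e μ))
      ∈ unitary (Matrix n n ℂ) :=
    (unitary (Matrix n n ℂ)).mul_mem ((unitary (Matrix n n ℂ)).mul_mem (NormedSpace.exp_mem_unitary_of_mem_skewAdjoint hs1)
      (NormedSpace.exp_mem_unitary_of_mem_skewAdjoint hs2)) (NormedSpace.exp_mem_unitary_of_mem_skewAdjoint (hΛ _))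
  have hq := norm_gaugeTwist_sub_one_le hW Λ R x μ (hΛs x) (hΛs (x + e μ)) (hRs x μ)
  have h := UnitaryRootInterpolation.smul_mlog_mem_skewAdjoint hu hq 1
  rw [one_smul] at h
  exact h

end Bookkeeping

/-! ## §2 The configuration identity -/

/-- **GAUGE EXTRACTION AS CONFIGURATIONS**: for `U(N)` data `W`, charges `‖Λ(x)‖ < 1∕64` and a remainder `‖R(b)‖ < 1∕64`,
`vary W (gaugeDir W Λ + R) 1 = gaugeAct (expGauge Λ 1) (vary W (gaugeExtract W Λ R) 1)` — the configuration reached from `W`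
along `gaugeDir W Λ + R` IS the gauge transform by `u = e^{Λ}` of the configuration reached along the extracted field `R′`
(bondwise leaf-10 g2's `val_mul_exp_gaugeDir_add`). [folklore] -/
theorem vary_gaugeDir_add_eq_gaugeAct [Nonempty n] {W : Site d → Fin d → (Matrix n n ℂ)ˣ} (hW : IsUnitaryCfg W)
    (Λ : Site d → Matrix n n ℂ) (R : Site d → Fin d → Matrix n n ℂ)
    (hΛ : ∀ x, ‖Λ x‖ < 1 / 64) (hR : ∀ x μ, ‖R x μ‖ < 1 / 64) :
    vary W (gaugeDir W Λ + R) 1 = gaugeAct (expGauge Λ 1) (vary W (gaugeExtract W Λ R) 1) := by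
  funext x μ
  apply Units.ext
  simp only [vary, gaugeAct, expGauge, Pi.add_apply, Units.val_mul, val_expUnit, val_inv_expUnit, Complex.ofReal_one,
    one_smul]
  exact val_mul_exp_gaugeDir_add hW Λ R x μ (by linarith [hΛ x]) (hΛ (x + e μ)) (hR x μ)

/-! ## §3 The interaction bound in configuration dress -/

/-- **POINTWISE**: `‖R′(b) − R(b)‖ ≤ 2048·(‖Λ(x)‖·‖Λ(x+e_μ)‖ + (‖Λ(x)‖ + ‖Λ(x+e_μ)‖)·‖R(b)‖)` — the product of the charges AT
THE TWO ENDS of the bond (zero for an isolated charge) plus charge × remainder; from leaf-10 g2's interaction form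
`‖Λ(x)‖·‖R(b) − Λ(x+e_μ)‖ + ‖Λ(x+e_μ)‖·‖R(b)‖` by the triangle inequality. [folklore] -/
theorem norm_gaugeExtract_sub_le_ends [Nonempty n] {W : Site d → Fin d → (Matrix n n ℂ)ˣ} (hW : IsUnitaryCfg W)
    (Λ : Site d → Matrix n n ℂ) (R : Site d → Fin d → Matrix n n ℂ) (x : Site d) (μ : Fin d)
    (hΛx : ‖Λ x‖ < 1 / 64) (hΛx' : ‖Λ (x + e μ)‖ < 1 / 64) (hR : ‖R x μ‖ < 1 / 64) :
    ‖gaugeExtract W Λ R x μ - R x μ‖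
      ≤ 2048 * (‖Λ x‖ * ‖Λ (x + e μ)‖ + (‖Λ x‖ + ‖Λ (x + e μ)‖) * ‖R x μ‖) := by
  have h := norm_gaugeExtract_sub_le hW Λ R x μ (by linarith) hΛx' hR
  have ht : ‖R x μ - Λ (x + e μ)‖ ≤ ‖R x μ‖ + ‖Λ (x + e μ)‖ := norm_sub_le _ _
  have h0 : 0 ≤ ‖Λ x‖ := norm_nonneg _
  have h1 : ‖Λ x‖ * ‖R x μ - Λ (x + e μ)‖ ≤ ‖Λ x‖ * (‖R x μ‖ + ‖Λ (x + e μ)‖) := mul_le_mul_of_nonneg_left ht h0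
  nlinarith [h, h1, norm_nonneg (Λ (x + e μ)), norm_nonneg (R x μ)]

/-- **SUP FORM**: with `‖Λ(x)‖ ≤ ℓ < 1∕64` for all sites and `‖R(b)‖ ≤ r < 1∕64` for all bonds,
`‖R′(b) − R(b)‖ ≤ 2048·(ℓ² + 2ℓr)` at every bond (the `ℓ²` is the NEIGHBOURING-charge product of the pointwise form — small in
`ℓ¹` for sparse charges even when it is not in sup). [folklore] -/
theorem norm_gaugeExtract_sub_le_sup [Nonempty n] {W : Site d → Fin d → (Matrix n n ℂ)ˣ} (hW : IsUnitaryCfg W)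
    (Λ : Site d → Matrix n n ℂ) (R : Site d → Fin d → Matrix n n ℂ) {ℓ r : ℝ} (hℓ : ∀ x, ‖Λ x‖ ≤ ℓ) (hℓs : ℓ < 1 / 64)
    (hr : ∀ x μ, ‖R x μ‖ ≤ r) (hrs : r < 1 / 64) (x : Site d) (μ : Fin d) :
    ‖gaugeExtract W Λ R x μ - R x μ‖ ≤ 2048 * (ℓ ^ 2 + 2 * ℓ * r) := by
  have h := norm_gaugeExtract_sub_le_ends hW Λ R x μ ((hℓ x).trans_lt hℓs) ((hℓ _).trans_lt hℓs) ((hr x μ).trans_lt hrs)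
  have a0 : 0 ≤ ‖Λ x‖ := norm_nonneg _
  have b0 : 0 ≤ ‖Λ (x + e μ)‖ := norm_nonneg _
  have c0 : 0 ≤ ‖R x μ‖ := norm_nonneg _
  have e1 : ‖Λ x‖ * ‖Λ (x + e μ)‖ ≤ ℓ * ℓ := mul_le_mul (hℓ x) (hℓ _) b0 (a0.trans (hℓ x))
  have e2 : (‖Λ x‖ + ‖Λ (x + e μ)‖) * ‖R x μ‖ ≤ (ℓ + ℓ) * r :=
    mul_le_mul (add_le_add (hℓ x) (hℓ _)) (hr x μ) c0 (by linarith [a0.trans (hℓ x)])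
  nlinarith [h, e1, e2]

/-! ## §4 Exactness at uncharged bonds -/

/-- **NO CHARGES ⇒ NOTHING EXTRACTED**: `gaugeExtract W 0 R (b) = R(b)` (`‖R(b)‖ < log 2`; tree `B7BlockAvgLog.mlog_exp`).
[folklore] -/
theorem gaugeExtract_zero_charge [Nonempty n] (W : Site d → Fin d → (Matrix n n ℂ)ˣ) (R : Site d → Fin d → Matrix n n ℂ)
    (x : Site d) (μ : Fin d) (hR : ‖R x μ‖ < Real.log 2) :
    gaugeExtract W (fun _ => 0) R x μ = R x μ := by
  simp only [gaugeExtract, gaugeDir, Ad, mul_zero, zero_mul, neg_zero, exp_zero, sub_zero, zero_add, one_mul, mul_one]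
  exact B7BlockAvgLog.mlog_exp hR

/-- **AN ISOLATED CHARGE IS EXTRACTED EXACTLY, I**: if the far end of the bond carries no charge (`Λ(x+e_μ) = 0`) and `R(b) = 0`,
then `gaugeExtract W Λ 0 (b) = 0` (the twist is `e^{−a}e^{a} = 1`). [folklore] -/
theorem gaugeExtract_zero_of_far_uncharged (W : Site d → Fin d → (Matrix n n ℂ)ˣ) (Λ : Site d → Matrix n n ℂ)
    (x : Site d) (μ : Fin d) (h : Λ (x + e μ) = 0) :
    gaugeExtract W Λ (fun _ _ => 0) x μ = 0 := by
  simp only [gaugeExtract, gaugeDir, h, sub_zero, add_zero, exp_zero, mul_one]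
  have hc : exp (-(Ad (W x μ)⁻¹ (Λ x))) * exp (Ad (W x μ)⁻¹ (Λ x)) = 1 := by
    have := (expUnit (Ad (W x μ)⁻¹ (Λ x))).inv_val
    simpa [expUnit] using this
  rw [hc, MatrixLog.mlog_one]

/-- **AN ISOLATED CHARGE IS EXTRACTED EXACTLY, II**: if the near end carries no charge (`Λ(x) = 0`) and `R(b) = 0`, then
`gaugeExtract W Λ 0 (b) = 0` (the twist is `e^{−Λ₊}e^{Λ₊} = 1`). [folklore] -/
theorem gaugeExtract_zero_of_near_uncharged (W : Site d → Fin d → (Matrix n n ℂ)ˣ) (Λ : Site d → Matrix n n ℂ)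
    (x : Site d) (μ : Fin d) (h : Λ x = 0) :
    gaugeExtract W Λ (fun _ _ => 0) x μ = 0 := by
  simp only [gaugeExtract, gaugeDir, h, Ad, mul_zero, zero_mul, neg_zero, exp_zero, zero_sub, add_zero, one_mul]
  have hc : exp (-(Λ (x + e μ))) * exp (Λ (x + e μ)) = 1 := by
    have := (expUnit (Λ (x + e μ))).inv_val
    simpa [expUnit] using this
  rw [hc, MatrixLog.mlog_one]

end

end Summit.QuantumFields.BalabanUV.T4Continuum.BlockAverageGaugeExtractCfg
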